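import Summits.Ventures.Crystal3D.Theorems.StickyWulffConstantNoReconstructionGainCosetFilm
import HarnessLib

/-!
# The coset rung on the whole lattice-symmetry orbit: every Shockley coset, every normal

HONEST FRAMING. Part of the venture `Summits/Ventures/Crystal3D` (cell `crystal3d-full`), helper
`--supports` the crux `NoReconstructionGain` (stmt-Ventures-19144, route
`route-Ventures-StickyWulffConstant`), line `adhesion`; continuation of `…CosetFilm`
(`cosetFilm_adhesion`: films inside `Λ₀ ∪ (Λ₀ + w)` for the basal Shockley offset
`w = barlowOffset 1`).  Here the offset is moved by an arbitrary linear isometry `g` of `ℝ³` that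
maps `Λ₀` onto itself (the 48 lattice symmetries; `g w` runs over the Shockley partials of all four
`{111}` families and both signs — `g = −1` gives `−w`):

* `cosetFilm_adhesion_orbit` (**the rung**, every `ν`, `R = 1`, `C = 0`; registered by name): for
  every unit `ν`, `ρ ≥ 1`, every finite unit packing `X ⊇ P` around the `ν`-slab sample whose film
  balls all lie in `Λ₀ ∪ (Λ₀ + g w)` for ONE lattice symmetry `g`:
  `#cross(P, X \ P) ≤ contactDeficiency (X \ P)`.

Proof: the substrate-free core `cosetFilm_cross_le` with offset `g w` and stratum axis `g e₃`; the
two contact laws are pulled back through `g⁻¹` to `fcc_coset_partner_below` /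
`fcc_sameCoset_height` (no transport of the configuration is needed).

WHAT THIS IS NOT: two different cosets at once (twins, hcp lamellae at inclined normals); rung F-C1
not moved.
-/

noncomputable section

namespace Summit.Ventures.Crystal3D.Theorems

open Summit.Ventures.Crystal3D Finset
open Literature.MathematicalPhysics.StatisticalMechanics (fccStacking barlowOffset orderedContacts
  contactDeficiency)
open scoped InnerProductSpace

/-- **Films inside `Λ₀ ∪ (Λ₀ + g w)` for a lattice symmetry `g`: the atom at every normal**
(`R = 1`, `C = 0`; registered by name on stmt-Ventures-19144). -/
theorem cosetFilm_adhesion_orbit :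
    ∃ R C : ℝ, 1 ≤ R ∧ ∀ ν : EuclideanSpace ℝ (Fin 3), ‖ν‖ = 1 → ∀ ρ : ℝ, R ≤ ρ →
      ∀ X P : Finset (EuclideanSpace ℝ (Fin 3)),
      (∀ p ∈ X, ∀ q ∈ X, p ≠ q → 1 ≤ dist p q) → P ⊆ X →
      (∀ p, p ∈ P ↔ (p ∈ fccStacking 1 (Real.sqrt (2 / 3)) ∧ -(2 * R) ≤ ⟪p, ν⟫_ℝ ∧
        ⟪p, ν⟫_ℝ ≤ -R ∧ ‖p‖ ^ 2 - ⟪p, ν⟫_ℝ ^ 2 ≤ ρ ^ 2)) →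
      (∃ g : EuclideanSpace ℝ (Fin 3) ≃ₗᵢ[ℝ] EuclideanSpace ℝ (Fin 3),
        (∀ p ∈ fccStacking 1 (Real.sqrt (2 / 3)), g p ∈ fccStacking 1 (Real.sqrt (2 / 3))) ∧
        (∀ p ∈ fccStacking 1 (Real.sqrt (2 / 3)), g.symm p ∈ fccStacking 1 (Real.sqrt (2 / 3))) ∧
        ∀ q ∈ X \ P, q ∈ fccStacking 1 (Real.sqrt (2 / 3)) ∨
          q - g (barlowOffset 1) ∈ fccStacking 1 (Real.sqrt (2 / 3))) →
      ((((P ×ˢ (X \ P)).filter fun pq => dist pq.1 pq.2 = 1).card : ℕ) : ℝ) ≤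
        contactDeficiency (X \ P) + C * ρ := by
  refine ⟨1, 0, le_rfl, fun ν hν ρ hρ X P hX hPX hP hfilm => ?_⟩
  obtain ⟨g, hg, hg', hfilm⟩ := hfilm
  rw [zero_mul, add_zero]
  set e3 : EuclideanSpace ℝ (Fin 3) := EuclideanSpace.single (2 : Fin 3) (1 : ℝ) with he3
  have hne3 : ‖e3‖ = 1 := by simp [he3]
  have hinner3 : ∀ v : EuclideanSpace ℝ (Fin 3), ⟪v, e3⟫_ℝ = v 2 := fun v => by
    simp [he3, EuclideanSpace.inner_single_right]
  have haxis : ‖g e3‖ = 1 := by rw [LinearIsometryEquiv.norm_map, hne3]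
  -- pull-back identities
  have hpull : ∀ a b : EuclideanSpace ℝ (Fin 3),
      ⟪a - b, g e3⟫_ℝ = (g.symm a) 2 - (g.symm b) 2 := fun a b => by
    rw [← g.symm.inner_map_map (a - b) (g e3), LinearIsometryEquiv.symm_apply_apply, map_sub,
      hinner3, PiLp.sub_apply]
  have hsub : ∀ q : EuclideanSpace ℝ (Fin 3), g.symm (q - g (barlowOffset 1)) = g.symm q - barlowOffset 1 :=
    fun q => by rw [map_sub, LinearIsometryEquiv.symm_apply_apply]
  have hdist : ∀ a b : EuclideanSpace ℝ (Fin 3), dist (g.symm a) (g.symm b) = dist a b :=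
    fun a b => g.symm.isometry.dist_eq a b
  refine cosetFilm_cross_le ν hν ρ hρ X P hX hPX hP (g (barlowOffset 1)) (g e3) haxis hfilm
    (fun y q hy hq hd => ?_) (fun x q hx hq hd => ?_)
  · -- a lattice partner of a `g w`-coset ball is one `g e₃`-layer below it
    have hy' : g.symm y ∈ fccStacking 1 (Real.sqrt (2 / 3)) := hg' y hy
    have hq' : g.symm q - barlowOffset 1 ∈ fccStacking 1 (Real.sqrt (2 / 3)) := by
      rw [← hsub]; exact hg' _ hq
    have hd' : dist (g.symm q) (g.symm y) = 1 := by rw [hdist]; exact hd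
    rw [hpull, fcc_coset_partner_below hy' hq' hd']
  · -- two balls of the same coset: height difference `0` or `±√(2/3)` along `g e₃`
    have hx' : g.symm x - barlowOffset 1 ∈ fccStacking 1 (Real.sqrt (2 / 3)) := by
      rw [← hsub]; exact hg' _ hx
    have hq' : g.symm q - barlowOffset 1 ∈ fccStacking 1 (Real.sqrt (2 / 3)) := by
      rw [← hsub]; exact hg' _ hq
    have hd' : dist (g.symm q) (g.symm x) = 1 := by rw [hdist]; exact hd
    rw [hpull]
    exact fcc_sameCoset_height hx' hq' hd'

end Summit.Ventures.Crystal3D.Theorems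

end
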